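import Mathlib
import Literature.Analysis.Convex.SchauderFixedPoint
import Summits.NavierStokesRegularity.NavierStokesRegularity.Theorems.WakeRatchetTailRatchetTruncationLimit
import HarnessLib

/-!
# `WakeRatchet.TailRatchet` (stmt-NavierStokesRegularity-21808): Schauder packaging of the truncated
# one-period map — `DyadicScalarFronts` from INVARIANT COMPACT CONVEX SETS

Support file for the crux `TailRatchet` (route `WakeRatchet`; MODEL lattice ODEs of Tao 2016 §4 —
nothing here is a statement about the Navier–Stokes equations).  Fourth brick of the reduction of the
blocking construction `DyadicScalarFronts` to the shape in which `PerpetualPump.CircuitPump` was proved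
(companions: `…LatticePeriod.lean` — unrolling with admissibility; `…TruncationLimit.lean` — truncation
limit; `…TruncatedFlow.lean` — energy conservation and the truncated flow).  Dyadic analogue of stub C2
(`stub_clampCovering`), in plain Schauder form:

* `truncatedPeriod_of_invariant` — a nonempty compact convex set `C` of lattice states vanishing off the
  window `|n| ≤ K` (floor `lo ≤ x_0`), a `K`-truncated dyadic flow `Φ` on `[0, Tmax]` from the states of
  `C` (coordinatewise jointly continuous, all-time box `|Φ x t n| ≤ b n`) and a continuous flight time
  `Tf : C → [Tmin, Tmax]`: if the ONE-PERIOD MAP `x ↦ (((1+Tf x)/Λ)⁻¹ Φ x (Tf x) (n+1))_{-K ≤ n ≤ K-1}`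
  (`0` elsewhere) maps `C` into `C`, then the truncated lattice has a relative periodic point — flight
  time in the window, interior matching `Z_n(T) = ((1+T)/Λ) Z_{n-1}(0)` (`|n| < K`), box and floor —
  exactly the hypothesis of `latticePeriod_of_truncations` at level `K` (transport to the window space
  `Icc (-K) K → ℝ`, the tree's Schauder theorem `Literature.Analysis.Convex.exists_fixedPoint_of_mapsTo_isCompact`,
  transport back);
* `dyadicScalarFronts_of_invariantSets`, `not_tailRatchet_of_invariantSets` — the full chain: such
  invariant sets at arbitrarily high `K`, with a `K`-uniform window / floor / envelope-dominated box, at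
  arbitrarily small `ε₀`, give `DyadicScalarFronts` and refute `TailRatchet`.

WHAT REMAINS (the whole mathematics of the front, stub-A analogue; not in print): for each small `ε₀`,
a window `[Tmin,Tmax]`, a floor, a `K`-uniform box dominated by the wake envelope `P((1+Tmax)/Λ)ⁿ`
(`n<0`) and the leading-edge envelope `B((1+Tmax)Λ)^{-n}` (`n≥0`), a continuous flight-time section and
compact convex sets `C_K` invariant under the one-period maps (positivity and the one-way energy flux of
the dyadic chain are the natural ingredients; the flow itself is supplied by `truncated_flow`).

HONEST FRAMING: a fixed-point packaging about a finite-dimensional MODEL ODE; no registered stub of the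
skeleton `Cruxes/TailRatchet/Lines/birth.lean` is closed, no summit statement is touched.
-/

noncomputable section

set_option linter.dupNamespace false

namespace Summit.NavierStokesRegularity.NavierStokesRegularity.Theorems

namespace WakeRatchetLatticePeriod

open Set Filter Topology
open Literature.Analysis.FluidPDE Literature.Analysis.FluidPDE.TaoCascade
open WakeRatchetDyadicFront

/-- **Relative periodic point of the truncated dyadic lattice from an invariant compact convex set
(dyadic analogue of stub C2 `stub_clampCovering` of `PerpetualPump.CircuitPump`, Schauder form).**
Let `C` be a nonempty compact convex set of lattice states vanishing off the window `|n| ≤ K`, `Φ` a flow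
of the `K`-truncated inviscid dyadic lattice on `[0, Tmax]` from the states of `C`, coordinatewise jointly
continuous on `C × [0, Tmax]` and obeying the all-time box `|Φ x t n| ≤ b n`, and `Tf : C → [Tmin, Tmax]`
a continuous flight-time function.  If the ONE-PERIOD MAP
`x ↦ (n ↦ ((1+Tf x)/Λ)⁻¹ · Φ x (Tf x) (n+1)` on `-K ≤ n ≤ K-1`, `0` elsewhere`)` maps `C` into `C`, then the
truncated lattice has a relative periodic point in the sense of `latticePeriod_of_truncations`: a
solution on `[0, Tmax]` in the box with flight time `T ∈ [Tmin, Tmax]`, the interior matching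
`Z_n(T) = ((1+T)/Λ) Z_{n-1}(0)` (`|n| < K`) and the floor `lo ≤ Z_0(0)` inherited from `C`
(transport to the finite-dimensional window space, the tree's Schauder theorem
`Literature.Analysis.Convex.exists_fixedPoint_of_mapsTo_isCompact`, transport back). [folklore] -/
theorem truncatedPeriod_of_invariant {L : ℝ} {K : ℕ} {Tmin Tmax lo : ℝ} (b : ℤ → ℝ)
    (C : Set (ℤ → ℝ)) (Tf : (ℤ → ℝ) → ℝ) (Φ : (ℤ → ℝ) → ℝ → (ℤ → ℝ))
    (hL : 0 < L) (hTmin : 0 < Tmin)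
    (hCconv : Convex ℝ C) (hCcomp : IsCompact C) (hCne : C.Nonempty)
    (hCK : ∀ x ∈ C, ∀ n : ℤ, (K : ℤ) < |n| → x n = 0)
    (hClo : ∀ x ∈ C, lo ≤ x 0)
    (hΦ : ∀ x ∈ C, (∀ n : ℤ, Φ x 0 n = x n) ∧
      (∀ n : ℤ, (K : ℤ) < |n| → ∀ t ∈ Icc (0 : ℝ) Tmax, Φ x t n = 0) ∧
      (∀ n : ℤ, |n| ≤ (K : ℤ) → ∀ t ∈ Icc (0 : ℝ) Tmax, HasDerivWithinAt (fun s => Φ x s n)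
        (L ^ (n - 1) * Φ x t (n - 1) ^ 2 - L ^ n * Φ x t n * Φ x t (n + 1)) (Icc (0 : ℝ) Tmax) t))
    (hΦc : ∀ n : ℤ, ContinuousOn (fun p : (ℤ → ℝ) × ℝ => Φ p.1 p.2 n) (C ×ˢ Icc (0 : ℝ) Tmax))
    (hb : ∀ x ∈ C, ∀ n : ℤ, ∀ t ∈ Icc (0 : ℝ) Tmax, |Φ x t n| ≤ b n)
    (hTc : ContinuousOn Tf C) (hTI : ∀ x ∈ C, Tf x ∈ Icc Tmin Tmax)
    (hinv : ∀ x ∈ C, (fun n : ℤ => if -(K : ℤ) ≤ n ∧ n ≤ (K : ℤ) - 1 then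
        ((1 + Tf x) / L)⁻¹ * Φ x (Tf x) (n + 1) else 0) ∈ C) :
    ∃ (T : ℝ) (Z : ℤ → ℝ → ℝ), T ∈ Icc Tmin Tmax ∧
      (∀ n : ℤ, |n| ≤ (K : ℤ) → ∀ t ∈ Icc (0 : ℝ) Tmax, HasDerivWithinAt (Z n)
        (L ^ (n - 1) * Z (n - 1) t ^ 2 - L ^ n * Z n t * Z (n + 1) t) (Icc (0 : ℝ) Tmax) t) ∧
      (∀ n : ℤ, (K : ℤ) < |n| → ∀ t ∈ Icc (0 : ℝ) Tmax, Z n t = 0) ∧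
      (∀ n : ℤ, ∀ t ∈ Icc (0 : ℝ) Tmax, |Z n t| ≤ b n) ∧
      (∀ n : ℤ, |n| < (K : ℤ) → Z n T = (1 + T) / L * Z (n - 1) 0) ∧
      lo ≤ Z 0 0 := by
  -- the one-period map
  set Ψ : (ℤ → ℝ) → (ℤ → ℝ) := fun x n => if -(K : ℤ) ≤ n ∧ n ≤ (K : ℤ) - 1 then
      ((1 + Tf x) / L)⁻¹ * Φ x (Tf x) (n + 1) else 0 with hΨ
  have hΨC : ∀ x ∈ C, Ψ x ∈ C := hinv
  -- transport to the finite-dimensional window space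
  set r : (ℤ → ℝ) → (↥(Set.Icc (-(K : ℤ)) (K : ℤ)) → ℝ) := fun x k => x k with hr
  set e : (↥(Set.Icc (-(K : ℤ)) (K : ℤ)) → ℝ) → (ℤ → ℝ) :=
    fun ξ n => if h : |n| ≤ (K : ℤ) then ξ ⟨n, abs_le.1 h⟩ else 0 with he
  have hrc : Continuous r := continuous_pi fun k => continuous_apply (k : ℤ)
  have hec : Continuous e := by
    refine continuous_pi fun n => ?_
    by_cases h : |n| ≤ (K : ℤ)
    · simp only [he, dif_pos h]; exact continuous_apply _
    · simp only [he, dif_neg h]; exact continuous_const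
  have her : ∀ x ∈ C, e (r x) = x := by
    intro x hx; funext n
    by_cases h : |n| ≤ (K : ℤ)
    · simp only [he, hr, dif_pos h]
    · simp only [he, dif_neg h]; exact (hCK x hx n (not_le.1 h)).symm
  have hre : ∀ ξ, r (e ξ) = ξ := by
    intro ξ; funext k
    have hk : |(k : ℤ)| ≤ (K : ℤ) := abs_le.2 (Set.mem_Icc.1 k.2)
    simp only [hr, he, dif_pos hk]
  set rL : (ℤ → ℝ) →ₗ[ℝ] (↥(Set.Icc (-(K : ℤ)) (K : ℤ)) → ℝ) :=
    { toFun := r, map_add' := fun x y => rfl, map_smul' := fun c x => rfl } with hrL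
  set CE : Set (↥(Set.Icc (-(K : ℤ)) (K : ℤ)) → ℝ) := r '' C with hCE
  have hCEconv : Convex ℝ CE := by
    have : CE = rL '' C := rfl
    rw [this]; exact hCconv.linear_image rL
  have hCEcomp : IsCompact CE := hCcomp.image hrc
  have hCEne : CE.Nonempty := hCne.image r
  -- continuity of the one-period map on `C` (product topology)
  have hΨc : ContinuousOn Ψ C := by
    refine continuousOn_pi.2 fun n => ?_
    by_cases hn : -(K : ℤ) ≤ n ∧ n ≤ (K : ℤ) - 1
    · have h1 : ContinuousOn (fun x => Φ x (Tf x) (n + 1)) C := by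
        have hmt : MapsTo (fun x : ℤ → ℝ => (x, Tf x)) C (C ×ˢ Icc (0 : ℝ) Tmax) :=
          fun x hx => ⟨hx, ⟨hTmin.le.trans (hTI x hx).1, (hTI x hx).2⟩⟩
        exact (hΦc (n + 1)).comp (continuousOn_id.prodMk hTc) hmt
      have h3 : ContinuousOn (fun x => (1 + Tf x) / L) C :=
        ContinuousOn.div_const (ContinuousOn.add continuousOn_const hTc) L
      have h2 : ContinuousOn (fun x => ((1 + Tf x) / L)⁻¹) C :=
        h3.inv₀ fun x hx => (div_pos (by linarith [(hTI x hx).1]) hL).ne'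
      refine (h2.mul h1).congr fun x _ => ?_
      simp only [hΨ, if_pos hn, Pi.mul_apply]
    · refine (continuousOn_const (c := (0 : ℝ))).congr fun x _ => ?_
      simp only [hΨ, if_neg hn]
  -- Schauder on the window space
  set F : (↥(Set.Icc (-(K : ℤ)) (K : ℤ)) → ℝ) → (↥(Set.Icc (-(K : ℤ)) (K : ℤ)) → ℝ) :=
    fun ξ => r (Ψ (e ξ)) with hF
  have heC : MapsTo e CE C := by
    rintro _ ⟨x, hx, rfl⟩; rw [her x hx]; exact hx
  have hFc : ContinuousOn F CE :=
    hrc.comp_continuousOn ((hΨc.comp hec.continuousOn heC))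
  have hFmaps : MapsTo F CE CE := by
    rintro _ ⟨x, hx, rfl⟩
    exact ⟨Ψ x, hΨC x hx, by simp only [hF, her x hx]⟩
  obtain ⟨ξ, hξ, hfix⟩ := Literature.Analysis.Convex.exists_fixedPoint_of_mapsTo_isCompact hCEconv
    hCEcomp.isClosed hCEne hCEcomp hFc hFmaps hFmaps
  -- the fixed point, back on the lattice
  set x : ℤ → ℝ := e ξ with hxdef
  have hxC : x ∈ C := heC hξ
  have hΨx : Ψ x = x := by
    have h1 : r (Ψ x) = r x := by rw [hxdef, hre]; exact hfix
    funext n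
    by_cases h : |n| ≤ (K : ℤ)
    · have := congr_fun h1 ⟨n, abs_le.1 h⟩
      simpa only [hr] using this
    · rw [hCK x hxC n (not_le.1 h)]
      have hn : ¬ (-(K : ℤ) ≤ n ∧ n ≤ (K : ℤ) - 1) := by
        rw [abs_le] at h; omega
      simp only [hΨ, if_neg hn]
  obtain ⟨h0, hz, hd⟩ := hΦ x hxC
  have hcpos : 0 < (1 + Tf x) / L := div_pos (by linarith [(hTI x hxC).1]) hL
  refine ⟨Tf x, fun n t => Φ x t n, hTI x hxC, fun n hn t ht => hd n hn t ht, hz,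
    fun n t ht => hb x hxC n t ht, fun n hn => ?_, ?_⟩
  · -- the interior matching from the fixed-point equation at `n - 1`
    have hn' : -(K : ℤ) ≤ n - 1 ∧ n - 1 ≤ (K : ℤ) - 1 := by rw [abs_lt] at hn; omega
    have := congr_fun hΨx (n - 1)
    simp only [hΨ, if_pos hn', sub_add_cancel] at this
    show Φ x (Tf x) n = (1 + Tf x) / L * Φ x 0 (n - 1)
    have hs0 : (1 + Tf x) ≠ 0 := (by linarith [(hTI x hxC).1] : (0 : ℝ) < 1 + Tf x).ne'
    rw [h0 (n - 1), ← this]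
    field_simp
  · show lo ≤ Φ x 0 0
    rw [h0 0]; exact hClo x hxC

/-- **`DyadicScalarFronts` from invariant compact convex sets of the truncated one-period maps.**
If at arbitrarily small scale ratios `Λ = (1+ε₀)^{5/2}` there are a flight-time window, a floor `lo > 0`
and an envelope-dominated box `b` such that at arbitrarily high truncation level `K` some nonempty
compact convex set `C` of window states (floor `lo ≤ x_0` on `C`) is mapped into itself by the one-period
map of a `K`-truncated dyadic flow obeying the all-time box `b`, with a continuous flight-time function,
then `DyadicScalarFronts` holds (`truncatedPeriod_of_invariant` → `dyadicScalarFronts_of_truncatedPeriods`).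
[cite: Tao2016AveragedNS, §1.2, §4 (4.8); cell vocabulary (`DyadicScalarFronts`)] -/
theorem dyadicScalarFronts_of_invariantSets
    (h : ∀ ε : ℝ, 0 < ε → ∃ ε₀ : ℝ, 0 < ε₀ ∧ ε₀ ≤ ε ∧
      ∃ (Tmin Tmax lo P B : ℝ) (b : ℤ → ℝ), 0 < Tmin ∧ Tmin ≤ Tmax ∧ 0 < lo ∧
      (∀ n : ℤ, n < 0 → b n ≤ P * ((1 + Tmax) / bigLam ε₀) ^ n) ∧
      (∀ n : ℤ, 0 ≤ n → b n ≤ B * (((1 + Tmax) * bigLam ε₀) ^ n)⁻¹) ∧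
      ∀ K₀ : ℕ, ∃ K : ℕ, K₀ ≤ K ∧
        ∃ (C : Set (ℤ → ℝ)) (Tf : (ℤ → ℝ) → ℝ) (Φ : (ℤ → ℝ) → ℝ → (ℤ → ℝ)),
          Convex ℝ C ∧ IsCompact C ∧ C.Nonempty ∧
          (∀ x ∈ C, ∀ n : ℤ, (K : ℤ) < |n| → x n = 0) ∧
          (∀ x ∈ C, lo ≤ x 0) ∧
          (∀ x ∈ C, (∀ n : ℤ, Φ x 0 n = x n) ∧
            (∀ n : ℤ, (K : ℤ) < |n| → ∀ t ∈ Icc (0 : ℝ) Tmax, Φ x t n = 0) ∧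
            (∀ n : ℤ, |n| ≤ (K : ℤ) → ∀ t ∈ Icc (0 : ℝ) Tmax, HasDerivWithinAt (fun s => Φ x s n)
              (bigLam ε₀ ^ (n - 1) * Φ x t (n - 1) ^ 2 - bigLam ε₀ ^ n * Φ x t n * Φ x t (n + 1))
              (Icc (0 : ℝ) Tmax) t)) ∧
          (∀ n : ℤ, ContinuousOn (fun p : (ℤ → ℝ) × ℝ => Φ p.1 p.2 n) (C ×ˢ Icc (0 : ℝ) Tmax)) ∧
          (∀ x ∈ C, ∀ n : ℤ, ∀ t ∈ Icc (0 : ℝ) Tmax, |Φ x t n| ≤ b n) ∧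
          ContinuousOn Tf C ∧ (∀ x ∈ C, Tf x ∈ Icc Tmin Tmax) ∧
          (∀ x ∈ C, (fun n : ℤ => if -(K : ℤ) ≤ n ∧ n ≤ (K : ℤ) - 1 then
            ((1 + Tf x) / bigLam ε₀)⁻¹ * Φ x (Tf x) (n + 1) else 0) ∈ C)) :
    DyadicScalarFronts := by
  refine dyadicScalarFronts_of_truncatedPeriods fun ε hε => ?_
  obtain ⟨ε₀, hε₀, hle, Tmin, Tmax, lo, P, B, b, hTmin, hTT, hlo, hbw, hbl, H⟩ := h ε hε
  have hΛ : 0 < bigLam ε₀ := bigLam_pos (by linarith)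
  refine ⟨ε₀, hε₀, hle, Tmin, Tmax, lo, P, B, b, hTmin, hTT, hlo, hbw, hbl, fun K₀ => ?_⟩
  obtain ⟨K, hK, C, Tf, Φ, hCconv, hCcomp, hCne, hCK, hClo, hΦ, hΦc, hb, hTc, hTI, hinv⟩ := H K₀
  obtain ⟨T, Z, hT, hD, hz, hbZ, hmatch, hfloor⟩ :=
    truncatedPeriod_of_invariant b C Tf Φ hΛ hTmin hCconv hCcomp hCne hCK hClo hΦ hΦc hb hTc hTI hinv
  exact ⟨K, hK, T, Z, hT, hD, hz, hbZ, hmatch, hfloor⟩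

/-- **Kill criterion for `TailRatchet`, Schauder form.**  Invariant compact convex sets of the truncated
one-period maps in envelope-dominated boxes at arbitrarily small scale ratios (as in
`dyadicScalarFronts_of_invariantSets`) refute `WakeRatchet.TailRatchet` (stmt-NavierStokesRegularity-21808).
[cite: Tao2016AveragedNS, §1.2, §4; cell vocabulary] -/
theorem not_tailRatchet_of_invariantSets
    (h : ∀ ε : ℝ, 0 < ε → ∃ ε₀ : ℝ, 0 < ε₀ ∧ ε₀ ≤ ε ∧
      ∃ (Tmin Tmax lo P B : ℝ) (b : ℤ → ℝ), 0 < Tmin ∧ Tmin ≤ Tmax ∧ 0 < lo ∧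
      (∀ n : ℤ, n < 0 → b n ≤ P * ((1 + Tmax) / bigLam ε₀) ^ n) ∧
      (∀ n : ℤ, 0 ≤ n → b n ≤ B * (((1 + Tmax) * bigLam ε₀) ^ n)⁻¹) ∧
      ∀ K₀ : ℕ, ∃ K : ℕ, K₀ ≤ K ∧
        ∃ (C : Set (ℤ → ℝ)) (Tf : (ℤ → ℝ) → ℝ) (Φ : (ℤ → ℝ) → ℝ → (ℤ → ℝ)),
          Convex ℝ C ∧ IsCompact C ∧ C.Nonempty ∧
          (∀ x ∈ C, ∀ n : ℤ, (K : ℤ) < |n| → x n = 0) ∧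
          (∀ x ∈ C, lo ≤ x 0) ∧
          (∀ x ∈ C, (∀ n : ℤ, Φ x 0 n = x n) ∧
            (∀ n : ℤ, (K : ℤ) < |n| → ∀ t ∈ Icc (0 : ℝ) Tmax, Φ x t n = 0) ∧
            (∀ n : ℤ, |n| ≤ (K : ℤ) → ∀ t ∈ Icc (0 : ℝ) Tmax, HasDerivWithinAt (fun s => Φ x s n)
              (bigLam ε₀ ^ (n - 1) * Φ x t (n - 1) ^ 2 - bigLam ε₀ ^ n * Φ x t n * Φ x t (n + 1))
              (Icc (0 : ℝ) Tmax) t)) ∧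
          (∀ n : ℤ, ContinuousOn (fun p : (ℤ → ℝ) × ℝ => Φ p.1 p.2 n) (C ×ˢ Icc (0 : ℝ) Tmax)) ∧
          (∀ x ∈ C, ∀ n : ℤ, ∀ t ∈ Icc (0 : ℝ) Tmax, |Φ x t n| ≤ b n) ∧
          ContinuousOn Tf C ∧ (∀ x ∈ C, Tf x ∈ Icc Tmin Tmax) ∧
          (∀ x ∈ C, (fun n : ℤ => if -(K : ℤ) ≤ n ∧ n ≤ (K : ℤ) - 1 then
            ((1 + Tf x) / bigLam ε₀)⁻¹ * Φ x (Tf x) (n + 1) else 0) ∈ C)) :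
    ¬ Summit.NavierStokesRegularity.NavierStokesRegularity.Theses.WakeRatchet.TailRatchet :=
  TailRatchet_false_of_DyadicScalarFronts (dyadicScalarFronts_of_invariantSets h)

end WakeRatchetLatticePeriod

end Summit.NavierStokesRegularity.NavierStokesRegularity.Theorems

end
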